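import Summits.HodgeConjecture.HodgeConjecture.Theorems.R90S1SplitOpenCellRootBoxes
import Literature.NumberTheory.Automorphic.Zelevinsky1980.DetCharInducingDatum
import Literature.NumberTheory.Automorphic.TateLocalZetaShells
import Literature.NumberTheory.Automorphic.IrreducibleClasses
import HarnessLib

/-!
# R90-TF · S1 «Ch10-local» · split place — values of the inducing datum `τ = ((σ ⊠ χ′) ∘ proj) ⊗ δ_P^{1∕2}` of `P(2,1) ≤ GL₃`

Cell `hodgecm-mathlib`, programme R90-TF, section S1, crux H413 (`stmt-HodgeConjecture-24833`), route `HCCMUnconditional`;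
prover seat R90-C10-p02, socket S1#7 `R90.S1.SocketSplitInducedIrreducible`, ROAD β.  THEOREMS ONLY (no `def`, no instance, no
notation, no `sorry`); helper file (bookkeeping for the socket's datum); lane `--supports stmt-HodgeConjecture-24833`.

For `σ` a representation of the `GL₂`-block `GL {i : Fin 3 // lastBlockLabel 3 i = false} F` on `W` and `χ′ : F^× → ℂ^×`, the
socket's Levi datum is `σ_L = (σ ∘ ev_false) ⊗ (χ′ ∘ det ∘ ev_true)` and the inducing representation of `P = Q_{2,1}` is
`τ = (σ_L ∘ proj) ⊗ δ_P^{1∕2}` (★ `Representation.parabolicIndGL F (lastBlockLabel 3) σ_L = Ind_P τ` by `rfl`).  We record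
(`ϖ` a uniformizer, `q = q_F`): the blocks of `u₁₀(b)`, `d(ϖ) = diag(1,1,ϖ)`, `d₀(ϖ) = diag(ϖ,1,1)`; `δ_P^{1∕2}(u₁₀ b) = 1`
(a commutator); **`τ(u₁₀ b) = σ(u₁₀ b)`**, **`τ(d(ϖ)) = q χ′(ϖ)`** (★ `coe_rootDeltaChar_diag_last_uniformizer`: `δ^{1∕2}(d(ϖ)) = (√q)²`),
**`τ(d₀(ϖ)) = (√q)⁻¹ σ(diag(ϖ,1))`** (★ `coe_rootDeltaChar_diag_zero_uniformizer`), `τ|_{U_P} = 1`, `τ(diag(A,1)) = δ^{1∕2} σ(A)`,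
smoothness of `σ_L` for `σ` smooth and `χ′` continuous, the inclusion of the `u₁₀`-Jacquet kernel of `σ` in that of `τ`, and the
second countability of the block.  Consumers: `R90S1SplitInducedEndScalarOfRegular` (and any assembly of S1#7 along road β).
HONEST LABEL: bookkeeping; HC_CM is proved only modulo the 7 printed citations (2 remaining named inputs: hLiu418 =
stmt-HodgeConjecture-24832, h413 = stmt-HodgeConjecture-24833) until rung 0 closes.
References: [BernsteinZelevinsky1977] Bernstein–Zelevinsky, Ann. Sci. ÉNS 10 (1977), 1.7–1.8, §7.1 · [Zelevinsky1980] §1.1, §3.2.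
-/

set_option autoImplicit false
set_option linter.dupNamespace false

noncomputable section

open Matrix Literature.LinearAlgebra.Matrix.DiagonalTorus
open Literature.NumberTheory.Automorphic Literature.NumberTheory.Automorphic.Zelevinsky1980
open Literature.NumberTheory.GaloisRepresentations
open ValuativeRel
open Summit.HodgeConjecture.HodgeConjecture.R90.S1.SplitCell

namespace Summit.HodgeConjecture.HodgeConjecture.R90.S1.SplitDatum

variable {F : Type*} [Field F]

/-! ## §1 Blocks of `u₁₀(b)`, `d(ϖ)`, `d₀(ϖ)`; `δ^{1/2}(u₁₀ b) = 1`; second countability -/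

/-- The `GL₂`-block of `u₁₀(b) ∈ P` is the transvection `u₁₀(b)` of the block, the `GL₁`-block is `1`.
[cite: Zelevinsky1980, §1.1] -/
theorem leviProjection_u10 (b : F) :
    leviProjection F (lastBlockLabel 3) ⟨transvectionGL (1 : Fin 3) 0 (by decide) b, u10_mem_standardParabolicGL b⟩ false =
        transvectionGL (⟨1, by decide⟩ : {i : Fin 3 // lastBlockLabel 3 i = false}) ⟨0, by decide⟩ (by decide) b ∧
      leviProjection F (lastBlockLabel 3) ⟨transvectionGL (1 : Fin 3) 0 (by decide) b, u10_mem_standardParabolicGL b⟩ true = 1 := by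
  constructor
  · refine Units.ext ?_
    ext ⟨i, hi⟩ ⟨j, hj⟩
    rw [coe_transvectionGL]
    change (Matrix.transvection (1 : Fin 3) 0 b) i j = _
    rw [Matrix.transvection, Matrix.transvection, Matrix.add_apply, Matrix.add_apply, Matrix.one_apply, Matrix.one_apply,
      Matrix.single_apply, Matrix.single_apply]
    simp only [Subtype.mk.injEq]
  · refine Units.ext ?_
    ext ⟨i, hi⟩ ⟨j, hj⟩
    change (Matrix.transvection (1 : Fin 3) 0 b) i j = _
    rw [Matrix.transvection, Matrix.add_apply, Matrix.one_apply, Units.val_one, Matrix.one_apply, Matrix.single_apply]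
    simp only [Subtype.mk.injEq]
    have hi2 : i = 2 := by fin_cases i <;> simp [lastBlockLabel_apply] at hi ⊢
    have hj2 : j = 2 := by fin_cases j <;> simp [lastBlockLabel_apply] at hj ⊢
    subst hi2 hj2
    simp

/-- The blocks of `d(t) = diag(1,1,t)`: `GL₂`-block `1`, `GL₁`-block with determinant `t`. [cite: Zelevinsky1980, §1.1] -/
theorem leviProjection_diag_last (t : Fˣ) :
    leviProjection F (lastBlockLabel 3) ⟨diagGL (Fin 3) (Function.update 1 (Fin.last 2) t), diagGL_mem_standardParabolicGL _ _⟩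
        false = 1 ∧
      Matrix.GeneralLinearGroup.det (leviProjection F (lastBlockLabel 3)
        ⟨diagGL (Fin 3) (Function.update 1 (Fin.last 2) t), diagGL_mem_standardParabolicGL _ _⟩ true) = t := by
  constructor
  · refine Units.ext ?_
    ext ⟨i, hi⟩ ⟨j, hj⟩
    change (Matrix.diagonal fun k => ((Function.update (1 : Fin 3 → Fˣ) (Fin.last 2) t k : Fˣ) : F)) i j = _
    rw [Units.val_one, Matrix.diagonal_apply, Matrix.one_apply]
    simp only [Subtype.mk.injEq]
    have hi2 : i ≠ Fin.last 2 := by rintro rfl; exact absurd hi (by decide)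
    rw [Function.update_of_ne hi2, Pi.one_apply, Units.val_one]
  · refine Units.ext ?_
    rw [Matrix.GeneralLinearGroup.val_det_apply]
    haveI : Subsingleton {i : Fin 3 // lastBlockLabel 3 i = true} := ⟨fun a b => Subtype.ext (by
      have ha : (a : Fin 3) = Fin.last 2 := by
        obtain ⟨a, ha⟩ := a; fin_cases a <;> simp [lastBlockLabel_apply] at ha ⊢
      have hb : (b : Fin 3) = Fin.last 2 := by
        obtain ⟨b, hb⟩ := b; fin_cases b <;> simp [lastBlockLabel_apply] at hb ⊢
      rw [ha, hb])⟩
    rw [Matrix.det_eq_elem_of_subsingleton _ ⟨Fin.last 2, by decide⟩]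
    change (Matrix.diagonal fun k => ((Function.update (1 : Fin 3 → Fˣ) (Fin.last 2) t k : Fˣ) : F)) (Fin.last 2) (Fin.last 2) = _
    rw [Matrix.diagonal_apply_eq, Function.update_self]

/-- The `GL₁`-block of `d₀(t) = diag(t,1,1)` is `1`. [cite: Zelevinsky1980, §1.1] -/
theorem leviProjection_diag_zero_true (t : Fˣ) :
    leviProjection F (lastBlockLabel 3) ⟨diagGL (Fin 3) (Function.update 1 0 t), diagGL_mem_standardParabolicGL _ _⟩ true = 1 := by
  refine Units.ext ?_
  ext ⟨i, hi⟩ ⟨j, hj⟩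
  change (Matrix.diagonal fun k => ((Function.update (1 : Fin 3 → Fˣ) 0 t k : Fˣ) : F)) i j = _
  rw [Units.val_one, Matrix.diagonal_apply, Matrix.one_apply]
  simp only [Subtype.mk.injEq]
  have hi0 : i ≠ 0 := by rintro rfl; exact absurd hi (by decide)
  rw [Function.update_of_ne hi0, Pi.one_apply, Units.val_one]


variable [ValuativeRel F] [TopologicalSpace F] [IsNonarchimedeanLocalField F]

/-- **`δ_P^{1∕2}(u₁₀(b)) = 1`**: `u₁₀(b)` is a commutator `d⁻¹ u₁₀(x) d u₁₀(x)⁻¹` in `P` (`d = diag(1, ϖ, 1)`,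
`x = b ∕ (ϖ⁻¹ - 1)`), and `δ_P^{1∕2}` takes values in the commutative group `ℂˣ`. [cite: BernsteinZelevinsky1977, §1.8] -/
theorem rootDeltaChar_u10 (b : F) :
    rootDeltaChar (standardParabolicGL F (lastBlockLabel 3))
      ⟨transvectionGL (1 : Fin 3) 0 (by decide) b, u10_mem_standardParabolicGL b⟩ = 1 := by
  obtain ⟨ϖ, hϖ⟩ := exists_isUniformizingElement (F := F)
  have hϖ0 : ϖ ≠ 0 := hϖ.ne_zero
  have hϖ1 : ϖ⁻¹ - 1 ≠ 0 := by
    intro h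
    have h1 : ϖ = 1 := by
      have := sub_eq_zero.1 h
      rw [inv_eq_one] at this
      exact this
    have := hϖ.valuation_lt_one
    rw [h1, map_one] at this
    exact lt_irrefl _ this
  set x : F := b / (ϖ⁻¹ - 1) with hx
  set u : Fin 3 → Fˣ := Function.update 1 1 (Units.mk0 ϖ hϖ0) with hu
  have hu0 : u 0 = 1 := by rw [hu, Function.update_of_ne (by decide), Pi.one_apply]
  have hu1 : u 1 = Units.mk0 ϖ hϖ0 := by rw [hu, Function.update_self]
  have hu2 : u 2 = 1 := by rw [hu, Function.update_of_ne (by decide), Pi.one_apply]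
  have hcomm : (diagGL (Fin 3) u)⁻¹ * transvectionGL (1 : Fin 3) 0 (by decide) x * diagGL (Fin 3) u *
      (transvectionGL (1 : Fin 3) 0 (by decide) x)⁻¹ = transvectionGL (1 : Fin 3) 0 (by decide) b := by
    have hb : ϖ⁻¹ * x + -x = b := by
      rw [show ϖ⁻¹ * x + -x = x * (ϖ⁻¹ - 1) by ring, hx]
      exact div_mul_cancel₀ b hϖ1
    rw [← transvectionGL_neg]
    refine Units.ext ?_
    ext i j
    rw [Units.val_mul, Matrix.mul_apply, Fin.sum_univ_three, coe_diagGL_inv_mul_mul_apply, coe_diagGL_inv_mul_mul_apply,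
      coe_diagGL_inv_mul_mul_apply, hu0, hu1, hu2]
    simp only [coe_transvectionGL, Units.val_one, mul_one]
    fin_cases i <;> fin_cases j <;> simp [Matrix.transvection, hu0, hu1, hu2, ← hb, inv_mul_cancel₀ hϖ0]
  set P := standardParabolicGL F (lastBlockLabel 3) with hP
  have hdP : diagGL (Fin 3) u ∈ P := diagGL_mem_standardParabolicGL _ _
  have hxP : transvectionGL (1 : Fin 3) 0 (by decide) x ∈ P := u10_mem_standardParabolicGL x
  have hel : (⟨transvectionGL (1 : Fin 3) 0 (by decide) b, u10_mem_standardParabolicGL b⟩ : ↥P) =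
      (⟨diagGL (Fin 3) u, hdP⟩ : ↥P)⁻¹ * ⟨transvectionGL (1 : Fin 3) 0 (by decide) x, hxP⟩ * ⟨diagGL (Fin 3) u, hdP⟩ *
        (⟨transvectionGL (1 : Fin 3) 0 (by decide) x, hxP⟩ : ↥P)⁻¹ :=
    Subtype.ext hcomm.symm
  rw [hel, map_mul, map_mul, map_mul, map_inv, map_inv, mul_right_comm _ _ (rootDeltaChar P ⟨diagGL (Fin 3) u, hdP⟩),
    inv_mul_cancel, one_mul, mul_inv_cancel]


/-- `GL₂(F)` (the `GL₂`-block) is second countable. [folklore] -/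
theorem secondCountableTopology_glBlock :
    SecondCountableTopology (GL {i : Fin 3 // lastBlockLabel 3 i = false} F) := by
  haveI : SecondCountableTopology F := secondCountableTopology_localField F
  haveI : SecondCountableTopology (Matrix {i : Fin 3 // lastBlockLabel 3 i = false} {i : Fin 3 // lastBlockLabel 3 i = false} F) :=
    inferInstanceAs (SecondCountableTopology (_ → _ → F))
  haveI : SecondCountableTopology (Matrix {i : Fin 3 // lastBlockLabel 3 i = false} {i : Fin 3 // lastBlockLabel 3 i = false} F)ᵐᵒᵖ :=
    MulOpposite.opHomeomorph.symm.secondCountableTopology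
  exact Units.isEmbedding_embedProduct.secondCountableTopology



/-! ## §2 Values of the inducing datum `τ = ((σ ⊠ χ′) ∘ proj) ⊗ δ_P^{1∕2}` -/

section Datum

variable {W : Type*} [AddCommGroup W] [Module ℂ W]
  (σ : Representation ℂ (GL {i : Fin 3 // lastBlockLabel 3 i = false} F) W) (χ' : Fˣ →* ℂˣ)

/-- The Levi datum `σ ⊠ χ′` is smooth for `σ` smooth and `χ′` continuous. [cite: BernsteinZelevinsky1977, §1.8] -/
theorem isSmooth_leviDatum (hσs : σ.IsSmooth) (hχ'c : Continuous fun x => ((χ' x : ℂˣ) : ℂ)) :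
    Representation.IsSmooth (Representation.twist
      (σ.comp (Pi.evalMonoidHom (fun a : Bool => GL {i : Fin 3 // lastBlockLabel 3 i = a} F) false))
      (χ'.comp (Matrix.GeneralLinearGroup.det.comp
        (Pi.evalMonoidHom (fun a : Bool => GL {i : Fin 3 // lastBlockLabel 3 i = a} F) true)))) := by
  have h1 : Representation.IsSmooth
      (σ.comp (Pi.evalMonoidHom (fun a : Bool => GL {i : Fin 3 // lastBlockLabel 3 i = a} F) false)) := by
    intro w
    have hs : IsOpen ((σ.stabilizerSubgroup w : Subgroup (GL {i : Fin 3 // lastBlockLabel 3 i = false} F)) :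
        Set (GL {i : Fin 3 // lastBlockLabel 3 i = false} F)) := (σ.isSmoothVector_iff w).1 (hσs w)
    show IsOpen ((fun m : (Π a : Bool, GL {i : Fin 3 // lastBlockLabel 3 i = a} F) => m false) ⁻¹'
      ((σ.stabilizerSubgroup w : Subgroup (GL {i : Fin 3 // lastBlockLabel 3 i = false} F)) :
        Set (GL {i : Fin 3 // lastBlockLabel 3 i = false} F)))
    exact hs.preimage (continuous_apply false)
  refine h1.twist ?_
  have hk : IsOpen ((χ'.ker : Subgroup Fˣ) : Set Fˣ) := Liu2021.SplitPlace.isOpen_ker_of_continuous χ' hχ'c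
  have hset : (((χ'.comp (Matrix.GeneralLinearGroup.det.comp
      (Pi.evalMonoidHom (fun a : Bool => GL {i : Fin 3 // lastBlockLabel 3 i = a} F) true))).ker :
        Subgroup (Π a : Bool, GL {i : Fin 3 // lastBlockLabel 3 i = a} F)) :
          Set (Π a : Bool, GL {i : Fin 3 // lastBlockLabel 3 i = a} F)) =
      (fun m : Π a : Bool, GL {i : Fin 3 // lastBlockLabel 3 i = a} F => Matrix.GeneralLinearGroup.det (m true)) ⁻¹'
        ((χ'.ker : Subgroup Fˣ) : Set Fˣ) := by
    ext m
    simp only [SetLike.mem_coe, MonoidHom.mem_ker, MonoidHom.comp_apply, Set.mem_preimage]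
    rfl
  rw [hset]
  exact hk.preimage (Matrix.GeneralLinearGroup.continuous_det.comp (continuous_apply true))

/-- **`τ(u₁₀ b) = σ(u₁₀ b)`** (`δ_P^{1∕2}(u₁₀ b) = 1`, the `GL₁`-block of `u₁₀(b)` is `1`). [cite: BernsteinZelevinsky1977, §1.8] -/
theorem twistDatum_u10 (b : F) (w : W) :
    (Representation.twist
        ((Representation.twist
          (σ.comp (Pi.evalMonoidHom (fun a : Bool => GL {i : Fin 3 // lastBlockLabel 3 i = a} F) false))
          (χ'.comp (Matrix.GeneralLinearGroup.det.comp
            (Pi.evalMonoidHom (fun a : Bool => GL {i : Fin 3 // lastBlockLabel 3 i = a} F) true)))).comp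
          (leviProjection F (lastBlockLabel 3)))
        (rootDeltaChar (standardParabolicGL F (lastBlockLabel 3)))) ⟨transvectionGL (1 : Fin 3) 0 (by decide) b, u10_mem_standardParabolicGL b⟩ w =
      σ (transvectionGL (⟨1, by decide⟩ : {i : Fin 3 // lastBlockLabel 3 i = false}) ⟨0, by decide⟩ (by decide) b) w := by
  simp only [Representation.twist_apply, MonoidHom.comp_apply, Pi.evalMonoidHom_apply, rootDeltaChar_u10,
    (leviProjection_u10 b).1, (leviProjection_u10 b).2, map_one, Units.val_one, one_smul]

/-- **`τ` is trivial on `U_P`.** [cite: BernsteinZelevinsky1977, §1.8] -/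
theorem twistDatum_unipotent (u : ↥(standardParabolicGL F (lastBlockLabel 3)))
    (hu : u ∈ unipotentRadicalP F (lastBlockLabel 3)) : (Representation.twist
        ((Representation.twist
          (σ.comp (Pi.evalMonoidHom (fun a : Bool => GL {i : Fin 3 // lastBlockLabel 3 i = a} F) false))
          (χ'.comp (Matrix.GeneralLinearGroup.det.comp
            (Pi.evalMonoidHom (fun a : Bool => GL {i : Fin 3 // lastBlockLabel 3 i = a} F) true)))).comp
          (leviProjection F (lastBlockLabel 3)))
        (rootDeltaChar (standardParabolicGL F (lastBlockLabel 3)))) u = 1 := by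
  refine LinearMap.ext fun w => ?_
  rw [Representation.twist_apply, rootDeltaChar_eq_one_of_mem_unipotentRadicalP F (lastBlockLabel 3) hu,
    MonoidHom.comp_apply, (MonoidHom.mem_ker).1 hu, map_one, Units.val_one, one_smul]

/-- **`τ(diag(A, 1)) = δ_P^{1∕2}(diag(A,1)) · σ(A)`** (the Levi section). [cite: BernsteinZelevinsky1977, §1.8] -/
theorem twistDatum_leviEmbedding (A : GL {i : Fin 3 // lastBlockLabel 3 i = false} F) (w : W) :
    (Representation.twist
        ((Representation.twist
          (σ.comp (Pi.evalMonoidHom (fun a : Bool => GL {i : Fin 3 // lastBlockLabel 3 i = a} F) false))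
          (χ'.comp (Matrix.GeneralLinearGroup.det.comp
            (Pi.evalMonoidHom (fun a : Bool => GL {i : Fin 3 // lastBlockLabel 3 i = a} F) true)))).comp
          (leviProjection F (lastBlockLabel 3)))
        (rootDeltaChar (standardParabolicGL F (lastBlockLabel 3)))) (leviEmbeddingP F (lastBlockLabel 3) (Pi.mulSingle false A)) w =
      ((rootDeltaChar (standardParabolicGL F (lastBlockLabel 3))
        (leviEmbeddingP F (lastBlockLabel 3) (Pi.mulSingle false A)) : ℂˣ) : ℂ) • σ A w := by
  rw [Representation.twist_apply, MonoidHom.comp_apply, leviProjection_leviEmbeddingP_apply,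
    Representation.twist_apply, MonoidHom.comp_apply, MonoidHom.comp_apply, MonoidHom.comp_apply,
    Pi.evalMonoidHom_apply, Pi.evalMonoidHom_apply, Pi.mulSingle_eq_same,
    Pi.mulSingle_eq_of_ne (show true ≠ false by decide), map_one, map_one, Units.val_one, one_smul]

/-- **`τ(d(ϖ)) = q · χ′(ϖ)`** for `d(ϖ) = diag(1,1,ϖ)` (`δ_P^{1∕2}(d(ϖ)) = (√q)²`, ★ `coe_rootDeltaChar_diag_last_uniformizer`).
[cite: BernsteinZelevinsky1977, 1.7] -/
theorem twistDatum_diag_last {ϖ : F} (hϖ : IsUniformizingElement ϖ) (w : W) :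
    (Representation.twist
        ((Representation.twist
          (σ.comp (Pi.evalMonoidHom (fun a : Bool => GL {i : Fin 3 // lastBlockLabel 3 i = a} F) false))
          (χ'.comp (Matrix.GeneralLinearGroup.det.comp
            (Pi.evalMonoidHom (fun a : Bool => GL {i : Fin 3 // lastBlockLabel 3 i = a} F) true)))).comp
          (leviProjection F (lastBlockLabel 3)))
        (rootDeltaChar (standardParabolicGL F (lastBlockLabel 3)))) ⟨diagGL (Fin 3) (Function.update 1 (Fin.last 2) (Units.mk0 ϖ hϖ.ne_zero)), diagGL_mem_standardParabolicGL _ _⟩ w =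
      ((IsNonarchimedeanLocalField.residueFieldCard F : ℂ) * ((χ' (Units.mk0 ϖ hϖ.ne_zero) : ℂˣ) : ℂ)) • w := by
  have hq : (Real.sqrt (IsNonarchimedeanLocalField.residueFieldCard F : ℝ) : ℂ) ^ (1 + 1) =
      (IsNonarchimedeanLocalField.residueFieldCard F : ℂ) := by
    rw [← Complex.ofReal_pow, show (1 + 1 : ℕ) = 2 from rfl, Real.sq_sqrt (Nat.cast_nonneg _), Complex.ofReal_natCast]
  rw [Representation.twist_apply, coe_rootDeltaChar_diag_last_uniformizer F hϖ, hq, MonoidHom.comp_apply,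
    Representation.twist_apply, MonoidHom.comp_apply, MonoidHom.comp_apply, MonoidHom.comp_apply, Pi.evalMonoidHom_apply,
    Pi.evalMonoidHom_apply, (leviProjection_diag_last _).1, (leviProjection_diag_last _).2, map_one, Module.End.one_apply,
    smul_smul]

/-- **`τ(d₀(ϖ)) = (√q)⁻¹ · σ(diag(ϖ,1))`** for `d₀(ϖ) = diag(ϖ,1,1)` (`δ_P^{1∕2}(d₀(ϖ)) = (√q)⁻¹`, ★
`coe_rootDeltaChar_diag_zero_uniformizer`; `diag(ϖ,1)` = the `GL₂`-block of `d₀(ϖ)`). [cite: BernsteinZelevinsky1977, 1.7] -/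
theorem twistDatum_diag_zero {ϖ : F} (hϖ : IsUniformizingElement ϖ) (w : W) :
    (Representation.twist
        ((Representation.twist
          (σ.comp (Pi.evalMonoidHom (fun a : Bool => GL {i : Fin 3 // lastBlockLabel 3 i = a} F) false))
          (χ'.comp (Matrix.GeneralLinearGroup.det.comp
            (Pi.evalMonoidHom (fun a : Bool => GL {i : Fin 3 // lastBlockLabel 3 i = a} F) true)))).comp
          (leviProjection F (lastBlockLabel 3)))
        (rootDeltaChar (standardParabolicGL F (lastBlockLabel 3)))) ⟨diagGL (Fin 3) (Function.update 1 0 (Units.mk0 ϖ hϖ.ne_zero)), diagGL_mem_standardParabolicGL _ _⟩ w =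
      (Real.sqrt (IsNonarchimedeanLocalField.residueFieldCard F : ℝ) : ℂ)⁻¹ •
        σ (leviProjection F (lastBlockLabel 3)
          ⟨diagGL (Fin 3) (Function.update 1 0 (Units.mk0 ϖ hϖ.ne_zero)), diagGL_mem_standardParabolicGL _ _⟩ false) w := by
  rw [Representation.twist_apply, coe_rootDeltaChar_diag_zero_uniformizer F hϖ, MonoidHom.comp_apply,
    Representation.twist_apply, MonoidHom.comp_apply, MonoidHom.comp_apply, MonoidHom.comp_apply, Pi.evalMonoidHom_apply,
    Pi.evalMonoidHom_apply, leviProjection_diag_zero_true, map_one, map_one, Units.val_one, one_smul]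

/-- The `u₁₀`-Jacquet kernel of `σ` lies in that of `τ` (generators agree: `τ(u₁₀ b) = σ(u₁₀ b)`).
[cite: BernsteinZelevinsky1977, Thm. 5.2] -/
theorem span_jacquet_le_ker (ι : Multiplicative F →* ↥(standardParabolicGL F (lastBlockLabel 3)))
    (hι : ∀ b : F, ((ι (Multiplicative.ofAdd b) : ↥(standardParabolicGL F (lastBlockLabel 3))) : GL (Fin 3) F) =
      transvectionGL (1 : Fin 3) 0 (by decide) b) :
    Submodule.span ℂ (Set.range fun bw : F × W =>
        σ (transvectionGL (⟨1, by decide⟩ : {i : Fin 3 // lastBlockLabel 3 i = false}) ⟨0, by decide⟩ (by decide) bw.1) bw.2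
          - bw.2) ≤
      Representation.Coinvariants.ker ((Representation.twist
        ((Representation.twist
          (σ.comp (Pi.evalMonoidHom (fun a : Bool => GL {i : Fin 3 // lastBlockLabel 3 i = a} F) false))
          (χ'.comp (Matrix.GeneralLinearGroup.det.comp
            (Pi.evalMonoidHom (fun a : Bool => GL {i : Fin 3 // lastBlockLabel 3 i = a} F) true)))).comp
          (leviProjection F (lastBlockLabel 3)))
        (rootDeltaChar (standardParabolicGL F (lastBlockLabel 3)))).comp ι) := by
  refine Submodule.span_le.2 ?_
  rintro _ ⟨⟨b, y⟩, rfl⟩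
  refine Representation.Coinvariants.mem_ker_of_eq (Multiplicative.ofAdd b) y _ ?_
  change (Representation.twist
        ((Representation.twist
          (σ.comp (Pi.evalMonoidHom (fun a : Bool => GL {i : Fin 3 // lastBlockLabel 3 i = a} F) false))
          (χ'.comp (Matrix.GeneralLinearGroup.det.comp
            (Pi.evalMonoidHom (fun a : Bool => GL {i : Fin 3 // lastBlockLabel 3 i = a} F) true)))).comp
          (leviProjection F (lastBlockLabel 3)))
        (rootDeltaChar (standardParabolicGL F (lastBlockLabel 3)))) (ι (Multiplicative.ofAdd b)) y - y = _
  rw [show ι (Multiplicative.ofAdd b) = ⟨transvectionGL (1 : Fin 3) 0 (by decide) b, u10_mem_standardParabolicGL b⟩ from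
    Subtype.ext (hι b), twistDatum_u10]

end Datum

end Summit.HodgeConjecture.HodgeConjecture.R90.S1.SplitDatum

end
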